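import Literature.ComputerArithmetic.Shewchuk1997.FastExpansionSum
import Literature.ComputerArithmetic.Shewchuk1997.ScaleExpansion
import Literature.ComputerArithmetic.BoldoMuller2011.ErrFmaAppr
import Mathlib.Tactic.Linarith
import Mathlib.Tactic.Positivity
import Mathlib.Tactic.Ring
import Mathlib.Tactic.NormNum

/-!
# Shewchuk 1997, §2.7: COMPRESS (Theorem 23)

HONEST FRAMING (venture CertifiedArithmetic / cell `pub-lowprec`; engines lane): shared numerical
engines serving client cells; rigour lives in the verifiers; every published number belongs to a
client cell's ledger, not to the engines group.  This file types a PUBLISHED result with citation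
tags; nothing in it is new mathematics.

Source: J. R. Shewchuk, *Adaptive precision floating-point arithmetic and fast robust geometric
predicates*, Discrete Comput. Geom. 18 (1997) 305–363 [Shewchuk1997], §2.7 "Compression and
approximation", Figure 15 and THEOREM 23 (pp. 331–333), in the setting of
`Shewchuk1997.ExpansionArithmetic` (radix 2, `p`-bit floats with gradual underflow `emin`, exact
rounding to nearest `fl`, expansions as lists SMALLEST COMPONENT FIRST, `Below` / `IsExpansion` /
`fastTwoSum`).

COMPRESS(e) (the pseudocode of p. 332; Figure 15 illustrates it).  Lines 1–9 traverse `e` from the largest component down: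
`Q ⇐ eₘ`; for `i = m−1 … 1`: `(Q, q) ⇐ FAST-TWO-SUM(Q, eᵢ)`; if `q ≠ 0` then `g_bottom ⇐ Q`,
`bottom ⇐ bottom − 1`, `Q ⇐ q`; finally `g_bottom ⇐ Q`.  We model this as `compressDown fl Q xs` on the
remaining components `xs` listed LARGEST FIRST, returning the pair (emitted `g`'s largest first,
`g_bottom`).  Lines 10–16 traverse the `g`'s from the smallest up: `Q ⇐ g_bottom`; for each later
`g`: `(Q, q) ⇐ FAST-TWO-SUM(g, Q)`; if `q ≠ 0` then `h_top ⇐ q`, `top ⇐ top + 1`; finally `h_top ⇐ Q`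
(Line 14 assigns the small roundoff `q`, as in the paper's public-domain C code; the scanned listing
prints `Q`).  We model this as `compressUp fl Q gs` (`gs` smallest first), returning `h` smallest
first; `compress fl e` chains the two.

**THEOREM 23** (`compress_spec`, any tie rule, `p ≥ 2`; the paper assumes `m ≥ 3` and
round-to-even, neither is needed except that NONADJACENT needs a rounding whose roundoff lies
2-below the rounded value, `RoundoffBelow 2`, which round-to-even has by Corollary 9): if `e` is a
nonoverlapping expansion of floats then `h = COMPRESS(e)` satisfies `Σ h = Σ e` (`sum_eq`), its
components are floats (`floats`), `h` is a nonoverlapping expansion — indeed `IsExpansion c h`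
whenever the roundoff of `fl` lies `c`-below the rounded value, `1 ≤ c` (`exp`; `c = 2`:
nonadjacent, `compress_nonadjacent_roundTiesEven`), "if `h ≠ 0`, none of the `hᵢ` will be zero" in
the sharper form "every component is nonzero, or `h` is the single component `[Σ e]`" (`nz`),
`h` has at most `m` components (`len`), and "`h_n` approximates `h` with an error smaller than
`ulp(h_n)`" (`approx`).

PROOF (the paper gives a sketch, p. 333; the invariants below are ours but each step is the
sketch's).  DOWN (`compressDown_spec`): FAST-TWO-SUM is exact because every remaining component
lies 1-below the carry (`|eᵢ| < |Q|`, or `Q = 0` and FAST-TWO-SUM(0, b) = (b, 0)); all remaining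
components lie below a COMMON quantum `2^s` of `Q` and `eᵢ` (`exists_grid_below_list`), so an
emitted roundoff `q ≠ 0`, a multiple of `2^s`, dominates everything still to come
(`|Σ rest| < 2^s ≤ |q|`, the sum bound `abs_sum_lt_two_zpow_of_isExpansion` of Lemma 15's file);
with `|q| ≤ ½ulp(Q ⊕ eᵢ)` this is the STAIR "`g_{j−1}` ≤ `ulp(g_j)`" of the sketch in the exact form
`|Σ_{k<j} g_k| < ulp(g_j)` (`DStair`), together with `|g_{j−1}| ≤ ulp(g_j)` (`IsChain`) and
`|g_j| ≥ 2^(emin+p)` for every emitted `g_j` (a rounded NON-representable sum).  UP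
(`compressUp_spec`, invariant `UpInv`): the carry satisfies `|Q| ≤ ulp(g)` for the next `g`
(so FAST-TWO-SUM(g, Q) is exact), the emitted `h`'s form an expansion lying `c`-below the carry,
and `|Σ h's| < ulp(Q)`; the bound `|Q'| ≤ ulp(g')` for the next step is the stair applied to the
exact identity `Q' + Σ h's = Σ_{k ≤ j} g_k`, both `Q'` and `ulp(g')` being multiples of the
quantum `ulp(g + Q)` (emitting step) or `ulp(Q)` (exact step) that strictly exceeds `|Σ h's|`
(`abs_le_two_zpow_of_onGrid`).

REFERENCE CHECK (not part of the formal content): an exhaustive integer model of COMPRESS under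
round-to-even (all nonoverlapping inputs with zeros interspersed; `p = 4`, exponents `≤ 8`, up to
5 components: 1 050 384 cases; also `p = 3`, `p = 5`) confirms every claim above, with
`|g_{j−1}| = ulp(g_j)` and `|Q| = ulp(g)` attained (e.g. `p = 4`, `e = ⟨15, 16, 320⟩`:
`g = ⟨−1, 32, 320⟩`, `h = ⟨−1, 352⟩`).

PROVED HERE (0 named facts, 0 sorry): `compressDown`, `compressUp`, `compress`; the toolkit
lemmas; `compressDown_spec`, `compressUp_spec`; **Theorem 23** `compress_spec`,
`compress_sum`, `compress_nonoverlapping`, `compress_pairwise_abs_lt`,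
`compress_nonadjacent_roundTiesEven`; a sanity evaluation of the model (`example`).

NOT TYPED: the running-time remarks, the use of COMPRESS inside the geometric predicates (§4),
the round-toward-zero variant.
-/

namespace Literature.ComputerArithmetic.Shewchuk1997

open Literature.ComputerArithmetic.JeannerodRump2018
open Literature.ComputerArithmetic.BoldoJeannerodMelquiondMuller2023 hiding twoSum
open Literature.ComputerArithmetic.JoldesMullerPopescu2017 (abs_fl_le_of_abs_le)
open Literature.ComputerArithmetic.BoldoMuller2011 (add_eq_zero_of_fl_add_eq_zero)

variable {p : ℕ} {emin : ℤ} {fl : ℚ → ℚ}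

/-! ### Toolkit: ulps, grids, sums -/

/-- A nonzero float is at least its ulp in magnitude (it is a nonzero integer multiple of it).
[cite: BoldoEtAl2023, §2.1 Def. 2.4] -/
theorem ulp_le_abs_of_isFloat {g : ℚ} (hg : IsFloat p emin g) (hg0 : g ≠ 0) :
    ulp p emin g ≤ |g| := by
  obtain ⟨K, hK⟩ := exists_eq_int_mul_ulp_of_isFloat (p := p) (emin := emin) hg
  have hu := ulp_pos (p := p) (emin := emin) g
  have hK0 : K ≠ 0 := by
    rintro rfl
    exact hg0 (by rw [hK]; simp)
  have h1 : (1 : ℚ) ≤ |(K : ℚ)| := by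
    rw [← Int.cast_abs]; exact_mod_cast Int.one_le_abs hK0
  have habs : |g| = |(K : ℚ)| * ulp p emin g := by
    conv_lhs => rw [hK]
    rw [abs_mul, abs_of_pos hu]
  rw [habs]
  exact le_mul_of_one_le_left hu.le h1

/-- A float lies on every grid `2^s` not coarser than its ulp. [cite: BoldoEtAl2023, §2.1] -/
theorem onGrid_of_two_zpow_le_ulp {g : ℚ} (hg : IsFloat p emin g) {s : ℤ}
    (hs : (2 : ℚ) ^ s ≤ ulp p emin g) : OnGrid s g := by
  obtain ⟨k, -, hk⟩ := exists_ulp_eq_two_zpow (p := p) (emin := emin) g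
  obtain ⟨K, hK⟩ := exists_eq_int_mul_ulp_of_isFloat (p := p) (emin := emin) hg
  rw [hk] at hK hs
  have hsk : s ≤ k := (zpow_le_zpow_iff_right₀ (by norm_num : (1 : ℚ) < 2)).mp hs
  exact (show OnGrid k g from ⟨K, hK⟩).mono hsk

/-- A multiple of `2^s` (`s ≥ emin`) that is NOT a `p`-bit float is at least `2^(s+p)` in magnitude
(smaller multiples have a significand of at most `p` bits). [cite: Shewchuk1997, §2.1 p. 308 (model)] -/
theorem two_zpow_le_abs_of_onGrid_of_not_isFloat {s : ℤ} (hs : emin ≤ s) {t : ℚ}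
    (ht : OnGrid s t) (hnf : ¬ IsFloat p emin t) : (2 : ℚ) ^ (s + p) ≤ |t| := by
  obtain ⟨r, rfl⟩ := ht
  by_contra hlt
  rw [not_le] at hlt
  have h2s : (0 : ℚ) < (2 : ℚ) ^ s := zpow_pos (by norm_num) _
  have h1 : |(r : ℚ)| * (2 : ℚ) ^ s < (2 : ℚ) ^ (p : ℤ) * (2 : ℚ) ^ s := by
    have := hlt
    rw [abs_mul, abs_of_pos h2s, zpow_add₀ (by norm_num : (2 : ℚ) ≠ 0), mul_comm ((2 : ℚ) ^ s)]
      at this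
    exact this
  have h2 : |(r : ℚ)| < (2 : ℚ) ^ (p : ℤ) := lt_of_mul_lt_mul_right h1 h2s.le
  rw [zpow_natCast, ← Int.cast_abs] at h2
  have hr : |r| < (2 : ℤ) ^ p := by exact_mod_cast h2
  exact hnf (isFloat_of_int_mul r s hr hs)

/-- `2^e ≤ |t| ⟹ 2^(e−p+1) ≤ ulp(t)`. [cite: BoldoEtAl2023, §2.1 Def. 2.4] -/
theorem two_zpow_le_ulp_of_le_abs (e : ℤ) {t : ℚ} (ht : (2 : ℚ) ^ e ≤ |t|) :
    (2 : ℚ) ^ (e - p + 1) ≤ ulp p emin t := by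
  have hpos : 0 < |t| := lt_of_lt_of_le (zpow_pos (by norm_num) _) ht
  have ht0 : t ≠ 0 := abs_pos.mp hpos
  rw [ulp_of_ne_zero ht0]
  apply zpow_le_zpow_right₀ (by norm_num : (1 : ℚ) ≤ 2)
  have : e ≤ Int.log 2 |t| :=
    (Int.zpow_le_iff_le_log (b := 2) (by norm_num) hpos).mp (by exact_mod_cast ht)
  exact le_max_of_le_right (by omega)

/-- `|t| ≤ 2·2^u` with `u ≥ emin`, `p ≥ 2` ⟹ `ulp(t) ≤ 2^u`. [cite: BoldoEtAl2023, §2.1 Def. 2.4] -/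
theorem ulp_le_two_zpow_of_abs_le (hp : 2 ≤ p) {u : ℤ} (hu : emin ≤ u) {t : ℚ}
    (ht : |t| ≤ 2 * (2 : ℚ) ^ u) : ulp p emin t ≤ (2 : ℚ) ^ u := by
  by_cases ht0 : t = 0
  · rw [ht0, ulp_zero]; exact zpow_le_zpow_right₀ (by norm_num) hu
  · rw [ulp_of_ne_zero ht0]
    apply zpow_le_zpow_right₀ (by norm_num : (1 : ℚ) ≤ 2)
    have hpos : 0 < |t| := abs_pos.mpr ht0
    have hu0 : (0 : ℚ) < (2 : ℚ) ^ u := zpow_pos (by norm_num) _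
    have h2 : |t| < (2 : ℚ) ^ (u + 2) := by
      have : (2 : ℚ) ^ (u + 2) = 2 ^ u * 4 := by
        rw [zpow_add₀ (by norm_num : (2 : ℚ) ≠ 0)]; norm_num
      rw [this]; linarith
    have hlog : Int.log 2 |t| < u + 2 :=
      (Int.lt_zpow_iff_log_lt (b := 2) (by norm_num) hpos).mp (by exact_mod_cast h2)
    exact max_le hu (by omega)

/-- GRID SEPARATION: a multiple `a` of `2^k` with `|a + r| < 2^u`, `|r| < 2^k`, `k ≤ u`, satisfies
`|a| ≤ 2^u` (the next multiple of `2^k` above `2^u` is `2^u + 2^k`).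
[cite: Shewchuk1997, §2.1 footnote 2] -/
theorem abs_le_two_zpow_of_onGrid {k u : ℤ} (hku : k ≤ u) {a r : ℚ} (ha : OnGrid k a)
    (hr : |r| < (2 : ℚ) ^ k) (hsum : |a + r| < (2 : ℚ) ^ u) : |a| ≤ (2 : ℚ) ^ u := by
  by_contra hlt
  rw [not_le] at hlt
  have h := (OnGrid.two_zpow hku).add_two_zpow_le ha.abs hlt
  have h1 : |a| ≤ |a + r| + |r| := by
    have := abs_add_le (a + r) (-r)
    rwa [abs_neg, add_neg_cancel_right] at this
  linarith

/-- The sum bound of Lemma 15's file for a list given LARGEST FIRST. [cite: Shewchuk1997, Lemma 15 p. 320] -/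
theorem abs_sum_lt_two_zpow_of_rev {l : List ℚ} (hl : ∀ x ∈ l, IsFloat p emin x)
    (hexp : IsExpansion 1 l.reverse) {s : ℤ} (hs : ∀ x ∈ l, |x| < (2 : ℚ) ^ s) :
    |l.sum| < (2 : ℚ) ^ s := by
  rw [← List.sum_reverse]
  exact abs_sum_lt_two_zpow_of_isExpansion (fun x hx => hl x (List.mem_reverse.mp hx)) hexp
    (fun x hx => hs x (List.mem_reverse.mp hx))

/-- A component lying 1-below two floats lies below a COMMON quantum `2^s ≥ 2^emin` of both.
[cite: Shewchuk1997, §2.1 footnote 2; Thm 23 p. 333 (proof)] -/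
theorem exists_grid_below_pair {Q x y : ℚ} (hQ : IsFloat p emin Q) (hx : IsFloat p emin x)
    (h1 : Below 1 y Q) (h2 : Below 1 y x) :
    ∃ s : ℤ, emin ≤ s ∧ OnGrid s Q ∧ OnGrid s x ∧ |y| < (2 : ℚ) ^ s := by
  obtain ⟨a, haQ, hya⟩ := h1
  obtain ⟨b, hbx, hyb⟩ := h2
  rw [one_mul] at hya hyb
  have hmin : |y| < (2 : ℚ) ^ (min a b) := by
    rcases min_choice a b with hm | hm <;> rw [hm] <;> assumption
  rcases le_or_gt emin (min a b) with hle | hgt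
  · exact ⟨min a b, hle, haQ.mono (min_le_left _ _), hbx.mono (min_le_right _ _), hmin⟩
  · exact ⟨emin, le_rfl, OnGrid.of_isFloat hQ, OnGrid.of_isFloat hx,
      hmin.trans (zpow_lt_zpow_right₀ (by norm_num) hgt)⟩

/-- All components lying 1-below two floats lie below ONE common quantum of both.
[cite: Shewchuk1997, §2.1 footnote 2; Thm 23 p. 333 (proof)] -/
theorem exists_grid_below_list {Q x : ℚ} (hQ : IsFloat p emin Q) (hx : IsFloat p emin x)
    {xs : List ℚ} (h : ∀ y ∈ xs, Below 1 y Q ∧ Below 1 y x) :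
    ∃ s : ℤ, emin ≤ s ∧ OnGrid s Q ∧ OnGrid s x ∧ ∀ y ∈ xs, |y| < (2 : ℚ) ^ s := by
  induction xs with
  | nil => exact ⟨emin, le_rfl, OnGrid.of_isFloat hQ, OnGrid.of_isFloat hx, by simp⟩
  | cons y ys ih =>
    obtain ⟨s₁, hs₁, hQ₁, hx₁, hys⟩ := ih fun z hz => h z (List.mem_cons_of_mem _ hz)
    obtain ⟨s₂, hs₂, hQ₂, hx₂, hy⟩ :=
      exists_grid_below_pair hQ hx (h y (by simp)).1 (h y (by simp)).2
    have mono : ∀ {m n : ℤ}, m ≤ n → (2 : ℚ) ^ m ≤ (2 : ℚ) ^ n :=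
      fun hmn => zpow_le_zpow_right₀ (by norm_num) hmn
    rcases le_total s₁ s₂ with h12 | h21
    · exact ⟨s₂, hs₂, hQ₂, hx₂, List.forall_mem_cons.mpr
        ⟨hy, fun z hz => (hys z hz).trans_le (mono h12)⟩⟩
    · exact ⟨s₁, hs₁, hQ₁, hx₁, List.forall_mem_cons.mpr ⟨hy.trans_le (mono h21), hys⟩⟩

/-- `2^(emin+p)` is a float. [cite: Shewchuk1997, §2.1 p. 308 (model)] -/
theorem isFloat_two_zpow_emin_add (hp : 1 ≤ p) : IsFloat p emin ((2 : ℚ) ^ (emin + p)) := by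
  have := isFloat_of_int_mul (p := p) (emin := emin) 1 (emin + p)
    (by rw [abs_one]; exact_mod_cast Nat.one_lt_two_pow (by omega : p ≠ 0)) (by omega)
  simpa using this

/-! ### The stair -/

/-- THE STAIR, largest component first: every component exceeds, by its ulp, the exact sum of all
the components after (below) it — the exact form of "g_{j−1} ≤ ulp(g_j)" in the proof sketch.
[cite: Shewchuk1997, Thm 23 p. 333 (proof)] -/
def DStair (p : ℕ) (emin : ℤ) : List ℚ → Prop
  | [] => True
  | g :: rest => |rest.sum| < ulp p emin g ∧ DStair p emin rest

/-- THE STAIR, smallest component first, relative to the exact sum `S` of everything already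
passed. [cite: Shewchuk1997, Thm 23 p. 333 (proof)] -/
def UStair (p : ℕ) (emin : ℤ) : ℚ → List ℚ → Prop
  | _, [] => True
  | S, g :: rest => |S| < ulp p emin g ∧ UStair p emin (S + g) rest

/-- Unfolding. [cite: Shewchuk1997, Thm 23 p. 333 (proof)] -/
theorem dStair_cons {g : ℚ} {rest : List ℚ} :
    DStair p emin (g :: rest) ↔ |rest.sum| < ulp p emin g ∧ DStair p emin rest := Iff.rfl

/-- Unfolding. [cite: Shewchuk1997, Thm 23 p. 333 (proof)] -/
theorem uStair_cons {S g : ℚ} {rest : List ℚ} :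
    UStair p emin S (g :: rest) ↔ |S| < ulp p emin g ∧ UStair p emin (S + g) rest := Iff.rfl

/-- The stair at an appended top component. [cite: Shewchuk1997, Thm 23 p. 333 (proof)] -/
theorem uStair_append_singleton (S : ℚ) (l : List ℚ) (d : ℚ) :
    UStair p emin S (l ++ [d]) ↔ UStair p emin S l ∧ |S + l.sum| < ulp p emin d := by
  induction l generalizing S with
  | nil => simp [UStair]
  | cons g l ih =>
    rw [List.cons_append, uStair_cons, uStair_cons, ih, List.sum_cons, ← add_assoc]
    tauto

/-- The two forms of the stair agree. [cite: Shewchuk1997, Thm 23 p. 333 (proof)] -/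
theorem uStair_reverse_of_dStair {ds : List ℚ} (h : DStair p emin ds) :
    UStair p emin 0 ds.reverse := by
  induction ds with
  | nil => exact trivial
  | cons d rest ih =>
    rw [List.reverse_cons, uStair_append_singleton]
    exact ⟨ih h.2, by rw [zero_add, List.sum_reverse]; exact h.1⟩

/-- The stair bounds the passed sum by the ulp of the next component.
[cite: Shewchuk1997, Thm 23 p. 333 (proof)] -/
theorem UStair.head_lt {S : ℚ} {l : List ℚ} (h : UStair p emin S l) {y : ℚ} (hy : y ∈ l.head?) :
    |S| < ulp p emin y := by
  cases l with
  | nil => simp at hy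
  | cons g rest =>
    have : g = y := by simpa using hy
    subst this
    exact (uStair_cons.mp h).1

/-! ### COMPRESS (the pseudocode of p. 332) -/

/-- Lines 1–9 of COMPRESS on the components below the carry `Q`, listed LARGEST FIRST:
`(Q, q) ⇐ FAST-TWO-SUM(Q, eᵢ)`; if `q ≠ 0` emit `Q` and continue with carry `q`, else continue
with carry `Q`.  Returns (emitted components largest first, `g_bottom`).
[cite: Shewchuk1997, §2.7 p. 332 (COMPRESS), Lines 1–9] -/
def compressDown (fl : ℚ → ℚ) : ℚ → List ℚ → List ℚ × ℚ
  | Q, [] => ([], Q)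
  | Q, x :: xs =>
    if (fastTwoSum fl Q x).2 = 0 then compressDown fl (fastTwoSum fl Q x).1 xs
    else ((fastTwoSum fl Q x).1 :: (compressDown fl (fastTwoSum fl Q x).2 xs).1,
      (compressDown fl (fastTwoSum fl Q x).2 xs).2)

/-- Lines 10–16 of COMPRESS on the `g`'s above the carry `Q`, listed SMALLEST FIRST:
`(Q, q) ⇐ FAST-TWO-SUM(gᵢ, Q)`; if `q ≠ 0` emit `h_top ⇐ q`; finally `h_top ⇐ Q`.  Returns `h`
smallest first. [cite: Shewchuk1997, §2.7 p. 332 (COMPRESS), Lines 10–16] -/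
def compressUp (fl : ℚ → ℚ) : ℚ → List ℚ → List ℚ
  | Q, [] => [Q]
  | Q, g :: gs =>
    if (fastTwoSum fl g Q).2 = 0 then compressUp fl (fastTwoSum fl g Q).1 gs
    else (fastTwoSum fl g Q).2 :: compressUp fl (fastTwoSum fl g Q).1 gs

/-- **COMPRESS(e)** for an expansion `e` listed smallest component first (`Q ⇐ eₘ`, then Lines
1–9 downwards, then Lines 10–16 upwards from `g_bottom`). [cite: Shewchuk1997, §2.7 p. 332 (COMPRESS)] -/
def compress (fl : ℚ → ℚ) (e : List ℚ) : List ℚ :=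
  match e.reverse with
  | [] => []
  | em :: rest => compressUp fl (compressDown fl em rest).2 (compressDown fl em rest).1.reverse

/-- Unfolding. [cite: Shewchuk1997, §2.7 p. 332 (COMPRESS)] -/
@[simp] theorem compressDown_nil (fl : ℚ → ℚ) (Q : ℚ) : compressDown fl Q [] = ([], Q) := rfl

/-- Unfolding, exact step. [cite: Shewchuk1997, §2.7 p. 332 (COMPRESS), Lines 3–8] -/
theorem compressDown_cons_of_eq_zero {Q x : ℚ} {xs : List ℚ} (h : (fastTwoSum fl Q x).2 = 0) :
    compressDown fl Q (x :: xs) = compressDown fl (fastTwoSum fl Q x).1 xs := by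
  simp [compressDown, h]

/-- Unfolding, emitting step. [cite: Shewchuk1997, §2.7 p. 332 (COMPRESS), Lines 3–8] -/
theorem compressDown_cons_of_ne_zero {Q x : ℚ} {xs : List ℚ} (h : (fastTwoSum fl Q x).2 ≠ 0) :
    compressDown fl Q (x :: xs) = ((fastTwoSum fl Q x).1 :: (compressDown fl (fastTwoSum fl Q x).2 xs).1,
      (compressDown fl (fastTwoSum fl Q x).2 xs).2) := by
  simp [compressDown, h]

/-- Unfolding. [cite: Shewchuk1997, §2.7 p. 332 (COMPRESS)] -/
@[simp] theorem compressUp_nil (fl : ℚ → ℚ) (Q : ℚ) : compressUp fl Q [] = [Q] := rfl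

/-- Unfolding, exact step. [cite: Shewchuk1997, §2.7 p. 332 (COMPRESS), Lines 11–15] -/
theorem compressUp_cons_of_eq_zero {Q g : ℚ} {gs : List ℚ} (h : (fastTwoSum fl g Q).2 = 0) :
    compressUp fl Q (g :: gs) = compressUp fl (fastTwoSum fl g Q).1 gs := by
  simp [compressUp, h]

/-- Unfolding, emitting step. [cite: Shewchuk1997, §2.7 p. 332 (COMPRESS), Lines 11–15] -/
theorem compressUp_cons_of_ne_zero {Q g : ℚ} {gs : List ℚ} (h : (fastTwoSum fl g Q).2 ≠ 0) :
    compressUp fl Q (g :: gs) = (fastTwoSum fl g Q).2 :: compressUp fl (fastTwoSum fl g Q).1 gs := by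
  simp [compressUp, h]

/-- SANITY CHECK of the model (an evaluation, not a claim of the paper): with `p = 4` and the
seven roundings that occur (`336 ↦ 320` is the round-to-even tie; the rest are exact),
COMPRESS`⟨15, 16, 320⟩ = ⟨−1, 352⟩` — downward sweep `g = ⟨−1, 32, 320⟩` (bottom first), upward
sweep `h₁ = −1`, `h₂ = 320 ⊕ 32 = 352`. [cite: Shewchuk1997, §2.7 p. 332 (COMPRESS)] -/
example {fl : ℚ → ℚ} (h0 : fl 0 = 0) (h1 : fl (-1) = -1) (h16 : fl 16 = 16) (h31 : fl 31 = 32)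
    (h32 : fl 32 = 32) (h336 : fl 336 = 320) (h352 : fl 352 = 352) :
    compress fl [15, 16, 320] = [-1, 352] := by
  norm_num [compress, compressDown, compressUp, fastTwoSum, h0, h1, h16, h31, h32, h336, h352]

/-! ### Lines 1–9: the downward sweep -/

/-- What the downward sweep delivers from carry `Q` over the remaining components `xs`
(largest first): exact sum, floats, the stair, the chain `|g_{j−1}| ≤ ulp(g_j)`, every emitted
component at least `2^(emin+p)`, at most `|xs|` emitted components, and the top of the output is
`fl(Q + an initial segment of xs)`. [cite: Shewchuk1997, Thm 23 p. 333 (proof)] -/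
structure DownOut (p : ℕ) (emin : ℤ) (fl : ℚ → ℚ) (Q : ℚ) (xs gs : List ℚ) (gb : ℚ) : Prop where
  sum_eq : gs.sum + gb = Q + xs.sum
  floats : ∀ g ∈ gs, IsFloat p emin g
  hgb : IsFloat p emin gb
  stair : DStair p emin (gs ++ [gb])
  chain : (gs ++ [gb]).IsChain (fun a b => |b| ≤ ulp p emin a)
  big : ∀ g ∈ gs, (2 : ℚ) ^ (emin + p) ≤ |g|
  len : gs.length ≤ xs.length
  head : ∃ pre, pre <+: xs ∧ (gs ++ [gb]).head? = some (fl (Q + pre.sum))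

/-- **Lines 1–9 are correct**: from a float carry `Q` above nonoverlapping float components `xs`
(largest first, each 1-below `Q`) the downward sweep delivers `DownOut`.
[cite: Shewchuk1997, Thm 23 p. 333 (proof)] -/
theorem compressDown_spec (hp : 2 ≤ p) (hfl : IsRoundNearest p emin fl) :
    ∀ (xs : List ℚ) (Q : ℚ), IsFloat p emin Q → (∀ y ∈ xs, IsFloat p emin y) →
      IsExpansion 1 xs.reverse → (∀ y ∈ xs, Below 1 y Q) →
      DownOut p emin fl Q xs (compressDown fl Q xs).1 (compressDown fl Q xs).2 := by
  have hp1 : 1 ≤ p := le_trans (by norm_num) hp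
  intro xs
  induction xs with
  | nil =>
    intro Q hQ _ _ _
    refine ⟨by simp, by simp, hQ, ?_, ?_, by simp, by simp, ⟨[], List.nil_prefix, ?_⟩⟩
    · simp only [compressDown_nil, List.nil_append, dStair_cons, List.sum_nil, abs_zero]
      exact ⟨ulp_pos _, trivial⟩
    · simp
    · simp [fl_eq_self hfl hQ]
  | cons x xs ih =>
    intro Q hQ hF hexp hbel
    have hx : IsFloat p emin x := hF x (by simp)
    have hxsF : ∀ y ∈ xs, IsFloat p emin y := fun y hy => hF y (List.mem_cons_of_mem _ hy)
    rw [List.reverse_cons] at hexp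
    have hexp' : IsExpansion 1 xs.reverse := hexp.sublist (List.sublist_append_left _ _)
    have hbelx : ∀ y ∈ xs, Below 1 y x := fun y hy =>
      (List.pairwise_append.mp hexp).2.2 y (List.mem_reverse.mpr hy) x (by simp)
    have hxQ : Below 1 x Q := hbel x (by simp)
    have hbel' : ∀ y ∈ xs, Below 1 y Q := fun y hy => hbel y (List.mem_cons_of_mem _ hy)
    by_cases hQ0 : Q = 0
    · -- FAST-TWO-SUM(0, x) = (x, 0): an exact step
      have hF0 : fastTwoSum fl Q x = (x, 0) := by rw [hQ0]; exact fastTwoSum_zero_left hfl hx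
      have hq : (fastTwoSum fl Q x).2 = 0 := by rw [hF0]
      rw [compressDown_cons_of_eq_zero hq, hF0]
      have out := ih x hx hxsF hexp' hbelx
      refine ⟨?_, out.floats, out.hgb, out.stair, out.chain, out.big,
        out.len.trans (by simp), ?_⟩
      · rw [out.sum_eq, hQ0, List.sum_cons, zero_add]
      · obtain ⟨pre, hpre, hhead⟩ := out.head
        exact ⟨x :: pre, List.cons_prefix_cons.mpr ⟨rfl, hpre⟩,
          by rw [hhead, hQ0, List.sum_cons, zero_add]⟩
    · have hxQ' : |x| ≤ |Q| := (hxQ.abs_lt le_rfl hQ0).le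
      obtain ⟨h1, -, h2, h4⟩ := fastTwoSum_exact hp1 hfl hQ hx hxQ'
      have hF12 := isFloat_fastTwoSum hfl Q x
      by_cases hq : (fastTwoSum fl Q x).2 = 0
      · -- exact step: the carry becomes `Q + x`
        rw [compressDown_cons_of_eq_zero hq]
        generalize hQn : (fastTwoSum fl Q x).1 = Qn at *
        have hQnval : Qn = Q + x := by rw [hq, add_zero] at h4; exact h4
        have hbelQn : ∀ y ∈ xs, Below 1 y Qn := by
          intro y hy
          obtain ⟨s, -, hsQ, hsx, hys⟩ := exists_grid_below_pair hQ hx (hbel' y hy) (hbelx y hy)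
          exact ⟨s, by rw [hQnval]; exact hsQ.add hsx, by rwa [one_mul]⟩
        have out := ih Qn hF12.1 hxsF hexp' hbelQn
        refine ⟨by rw [out.sum_eq, hQnval, List.sum_cons, add_assoc], out.floats, out.hgb,
          out.stair, out.chain, out.big, out.len.trans (by simp), ?_⟩
        obtain ⟨pre, hpre, hhead⟩ := out.head
        exact ⟨x :: pre, List.cons_prefix_cons.mpr ⟨rfl, hpre⟩,
          by rw [hhead, hQnval, List.sum_cons, add_assoc]⟩
      · -- emitting step: `Qn` is emitted, the carry becomes the roundoff `q`
        rw [compressDown_cons_of_ne_zero hq]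
        generalize hQn : (fastTwoSum fl Q x).1 = Qn at *
        generalize hqn : (fastTwoSum fl Q x).2 = q at *
        -- every later component lies 1-below `q`
        have hbelq : ∀ y ∈ xs, Below 1 y q := by
          intro y hy
          obtain ⟨s, hs, hsQ, hsx, hys⟩ := exists_grid_below_pair hQ hx (hbel' y hy) (hbelx y hy)
          have hst : OnGrid s (Q + x) := hsQ.add hsx
          exact ⟨s, by rw [h2]; exact hst.sub (hst.fl_of hp1 hfl hs), by rwa [one_mul]⟩
        have out := ih q hF12.2 hxsF hexp' hbelq
        -- a common quantum below `Q` and `x` and above all of `xs`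
        obtain ⟨s, hs, hsQ, hsx, hall⟩ :=
          exists_grid_below_list hQ hx (fun y hy => ⟨hbel' y hy, hbelx y hy⟩)
        have hst : OnGrid s (Q + x) := hsQ.add hsx
        have hsq : OnGrid s q := by rw [h2]; exact hst.sub (hst.fl_of hp1 hfl hs)
        have h2s_le_q : (2 : ℚ) ^ s ≤ |q| := hsq.two_zpow_le_abs hq
        have hq_half : |q| ≤ ulp p emin Qn / 2 := by
          rw [h2, h1]; exact abs_sub_fl_le_half_ulp_fl hp1 hfl (Q + x)
        have hxs_sum : |xs.sum| < (2 : ℚ) ^ s := abs_sum_lt_two_zpow_of_rev hxsF hexp' hall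
        have hrest : |q + xs.sum| < ulp p emin Qn :=
          calc |q + xs.sum| ≤ |q| + |xs.sum| := abs_add_le _ _
            _ < |q| + (2 : ℚ) ^ s := by linarith
            _ ≤ ulp p emin Qn := by linarith
        -- `Qn` is a rounded NON-representable sum, hence at least `2^(emin+p)`
        have hnf : ¬ IsFloat p emin (Q + x) := fun hf => hq (by rw [h2, fl_eq_self hfl hf, sub_self])
        have hQnbig : (2 : ℚ) ^ (emin + p) ≤ |Qn| := by
          have h2pos : (0 : ℚ) < (2 : ℚ) ^ (emin + p) := zpow_pos (by norm_num) _
          have ht : (2 : ℚ) ^ (emin + p) ≤ |Q + x| :=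
            two_zpow_le_abs_of_onGrid_of_not_isFloat le_rfl
              ((OnGrid.of_isFloat hQ).add (OnGrid.of_isFloat hx)) hnf
          have ht' : |(2 : ℚ) ^ (emin + p)| ≤ |Q + x| := by rwa [abs_of_pos h2pos]
          have := abs_le_abs_fl hfl (isFloat_two_zpow_emin_add (emin := emin) hp1) ht'
          rw [abs_of_pos h2pos, ← h1] at this
          exact this
        refine ⟨?_, List.forall_mem_cons.mpr ⟨hF12.1, out.floats⟩, out.hgb, ?_, ?_,
          List.forall_mem_cons.mpr ⟨hQnbig, out.big⟩, ?_, ?_⟩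
        · simp only [List.sum_cons]; linarith [out.sum_eq, h4]
        · rw [List.cons_append, dStair_cons, List.sum_append, List.sum_cons, List.sum_nil,
            add_zero, out.sum_eq]
          exact ⟨hrest, out.stair⟩
        · rw [List.cons_append, List.isChain_cons]
          refine ⟨?_, out.chain⟩
          obtain ⟨pre, hpre, hhead⟩ := out.head
          intro y hy
          rw [hhead] at hy
          have hyv : fl (q + pre.sum) = y := by simpa using hy
          rw [← hyv]
          have hpreF : ∀ z ∈ pre, IsFloat p emin z := fun z hz => hxsF z (hpre.sublist.subset hz)
          have hpreE : IsExpansion 1 pre.reverse :=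
            hexp'.sublist (List.reverse_sublist.mpr hpre.sublist)
          have hpre_sum : |pre.sum| < (2 : ℚ) ^ s :=
            abs_sum_lt_two_zpow_of_rev hpreF hpreE fun z hz => hall z (hpre.sublist.subset hz)
          have hle : |q + pre.sum| ≤ ulp p emin Qn :=
            calc |q + pre.sum| ≤ |q| + |pre.sum| := abs_add_le _ _
              _ ≤ |q| + (2 : ℚ) ^ s := by linarith
              _ ≤ ulp p emin Qn := by linarith
          exact abs_fl_le_of_abs_le hfl (isFloat_ulp hp1 Qn) hle
        · exact Nat.succ_le_succ out.len
        · refine ⟨[x], List.cons_prefix_cons.mpr ⟨rfl, List.nil_prefix⟩, ?_⟩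
          simp [h1]

/-! ### Lines 10–16: the upward sweep -/

/-- INVARIANT of the upward sweep: `rs` = the components emitted so far, MOST RECENT FIRST, `Q` the
carry: all floats; the emitted components form an expansion of nonzero numbers each lying `c`-below
the later ones; the most recent lies `c`-below the (then nonzero) carry; and their exact sum is
below `ulp(Q)`. [cite: Shewchuk1997, Thm 23 p. 333 (proof)] -/
structure UpInv (p : ℕ) (emin : ℤ) (c : ℚ) (rs : List ℚ) (Q : ℚ) : Prop where
  floats : ∀ h ∈ rs, IsFloat p emin h
  hQ : IsFloat p emin Q
  pw : rs.Pairwise (fun a b => Below c b a)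
  ne : ∀ h ∈ rs, h ≠ 0
  hd : ∀ r ∈ rs.head?, Below c r Q ∧ Q ≠ 0
  sum_lt : |rs.sum| < ulp p emin Q

/-- Every emitted component lies `c`-below the carry. [cite: Shewchuk1997, Thm 23 p. 333 (proof)] -/
theorem UpInv.below_of_mem {c : ℚ} (hc : 1 ≤ c) {rs : List ℚ} {Q : ℚ} (inv : UpInv p emin c rs Q) :
    ∀ h ∈ rs, Below c h Q := by
  cases rs with
  | nil => simp
  | cons r rs₀ =>
    obtain ⟨hrQ, -⟩ := inv.hd r (by simp)
    have hr0 : r ≠ 0 := inv.ne r (by simp)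
    intro h hh
    rcases List.mem_cons.mp hh with rfl | hh
    · exact hrQ
    · exact hrQ.mono_left (by linarith)
        (((List.pairwise_cons.mp inv.pw).1 h hh).abs_lt hc hr0).le

/-- THE EMITTING STEP of the upward sweep (`q ≠ 0`): the invariant passes to `(q :: rs, Qn)` and
the emitted sum stays below the ulp of the EXACT sum `g + Q`.
[cite: Shewchuk1997, Thm 23 p. 333 (proof)] -/
theorem UpInv.emit (hp : 2 ≤ p) (hfl : IsRoundNearest p emin fl) {c : ℚ} (hc : 1 ≤ c)
    (hflc : RoundoffBelow c fl) {rs : List ℚ} {Q g : ℚ} (inv : UpInv p emin c rs Q)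
    (hg : IsFloat p emin g) (hgbig : (2 : ℚ) ^ (emin + p) ≤ |g|) (hQg : |Q| ≤ ulp p emin g)
    (hq : (fastTwoSum fl g Q).2 ≠ 0) :
    UpInv p emin c ((fastTwoSum fl g Q).2 :: rs) (fastTwoSum fl g Q).1 ∧
      |(fastTwoSum fl g Q).2 + rs.sum| < ulp p emin (g + Q) := by
  have hp1 : 1 ≤ p := le_trans (by norm_num) hp
  have hg0 : g ≠ 0 := by
    intro h; rw [h, abs_zero] at hgbig
    exact absurd hgbig (not_le.mpr (zpow_pos (by norm_num) _))
  have hulpg : ulp p emin g ≤ |g| := ulp_le_abs_of_isFloat hg hg0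
  have hQleg : |Q| ≤ |g| := hQg.trans hulpg
  obtain ⟨h1, -, h2, h4⟩ := fastTwoSum_exact hp1 hfl hg inv.hQ hQleg
  have hF12 := isFloat_fastTwoSum hfl g Q
  generalize hQn : (fastTwoSum fl g Q).1 = Qn at *
  generalize hqn : (fastTwoSum fl g Q).2 = q at *
  have hq_half : |q| ≤ ulp p emin (g + Q) / 2 := by
    rw [h2]; exact abs_sub_fl_le_half_ulp hp1 hfl _
  have hulp_t : ulp p emin (g + Q) ≤ ulp p emin Qn := by rw [h1]; exact ulp_le_ulp_fl hp1 hfl _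
  have hnf : ¬ IsFloat p emin (g + Q) := fun hf => hq (by rw [h2, fl_eq_self hfl hf, sub_self])
  have hQn0 : Qn ≠ 0 := by
    intro h0
    have : g + Q = 0 :=
      add_eq_zero_of_fl_add_eq_zero hp1 hfl hg inv.hQ (by rw [← h1]; exact h0)
    exact hq (by rw [h2, this, fl_zero hfl, sub_zero])
  have hbelow_q : Below c q Qn := by rw [h2, h1]; exact hflc (g + Q)
  have hupos := ulp_pos (p := p) (emin := emin) (g + Q)
  cases rs with
  | nil =>
    refine ⟨⟨by simpa using hF12.2, hF12.1, List.pairwise_singleton _ _, by simpa using hq, ?_, ?_⟩,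
      by simp only [List.sum_nil, add_zero]; linarith⟩
    · intro r hr
      have : q = r := by simpa using hr
      subst this
      exact ⟨hbelow_q, hQn0⟩
    · simp only [List.sum_cons, List.sum_nil, add_zero]
      linarith
  | cons r rs₀ =>
    obtain ⟨hrQ, hQ0⟩ := inv.hd r (by simp)
    obtain ⟨s, hs, hsQ, hrs⟩ := hrQ.normalize inv.hQ
    have h2s : (2 : ℚ) ^ s ≤ |Q| := hsQ.two_zpow_le_abs hQ0
    have hsg : OnGrid s g := onGrid_of_two_zpow_le_ulp hg (h2s.trans hQg)
    have hst : OnGrid s (g + Q) := hsg.add hsQ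
    have hsq : OnGrid s q := by rw [h2]; exact hst.sub (hst.fl_of hp1 hfl hs)
    have hr0 : r ≠ 0 := inv.ne r (by simp)
    have hle_r : ∀ h ∈ r :: rs₀, |h| ≤ |r| := by
      intro h hh
      rcases List.mem_cons.mp hh with rfl | hh
      · exact le_rfl
      · exact (((List.pairwise_cons.mp inv.pw).1 h hh).abs_lt hc hr0).le
    have hr_lt : |r| < (2 : ℚ) ^ s := by
      have : |r| ≤ c * |r| := le_mul_of_one_le_left (abs_nonneg _) hc
      linarith
    have hlt_s : ∀ h ∈ r :: rs₀, |h| < (2 : ℚ) ^ s := fun h hh => (hle_r h hh).trans_lt hr_lt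
    have hbel_hq : ∀ h ∈ r :: rs₀, Below c h q := fun h hh =>
      ⟨s, hsq, lt_of_le_of_lt (mul_le_mul_of_nonneg_left (hle_r h hh) (by linarith)) hrs⟩
    have hexp1 : IsExpansion 1 (r :: rs₀).reverse :=
      IsExpansion.anti (List.pairwise_reverse.mpr inv.pw) hc
    have hsum_s : |(r :: rs₀).sum| < (2 : ℚ) ^ s :=
      abs_sum_lt_two_zpow_of_rev inv.floats hexp1 hlt_s
    -- `g + Q` is a NON-representable multiple of `2^s`, so `2^(s+1) ≤ ulp(g + Q)`
    have hbig_t : (2 : ℚ) ^ (s + p) ≤ |g + Q| :=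
      two_zpow_le_abs_of_onGrid_of_not_isFloat hs hst hnf
    have hulp_t2 : 2 * (2 : ℚ) ^ s ≤ ulp p emin (g + Q) := by
      have h := two_zpow_le_ulp_of_le_abs (p := p) (emin := emin) (s + p) hbig_t
      have e : s + (p : ℤ) - p + 1 = s + 1 := by ring
      rw [e, zpow_add_one₀ (by norm_num : (2 : ℚ) ≠ 0)] at h
      linarith
    have hbound : |q + (r :: rs₀).sum| < ulp p emin (g + Q) :=
      calc |q + (r :: rs₀).sum| ≤ |q| + |(r :: rs₀).sum| := abs_add_le _ _
        _ < ulp p emin (g + Q) / 2 + (2 : ℚ) ^ s := by linarith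
        _ ≤ ulp p emin (g + Q) := by linarith
    refine ⟨⟨List.forall_mem_cons.mpr ⟨hF12.2, inv.floats⟩, hF12.1,
      List.pairwise_cons.mpr ⟨hbel_hq, inv.pw⟩, List.forall_mem_cons.mpr ⟨hq, inv.ne⟩, ?_, ?_⟩,
      hbound⟩
    · intro r' hr'
      have : q = r' := by simpa using hr'
      subst this
      exact ⟨hbelow_q, hQn0⟩
    · rw [List.sum_cons]; exact hbound.trans_le hulp_t

/-- THE EXACT STEP of the upward sweep (`q = 0`): the carry becomes `g + Q` exactly, the invariant
passes to `(rs, g + Q)`, and the carry does not shrink. [cite: Shewchuk1997, Thm 23 p. 333 (proof)] -/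
theorem UpInv.absorb (hp : 2 ≤ p) (hfl : IsRoundNearest p emin fl) {c : ℚ}
    {rs : List ℚ} {Q g : ℚ} (inv : UpInv p emin c rs Q)
    (hg : IsFloat p emin g) (hgbig : (2 : ℚ) ^ (emin + p) ≤ |g|) (hQg : |Q| ≤ ulp p emin g)
    (hq : (fastTwoSum fl g Q).2 = 0) :
    UpInv p emin c rs (fastTwoSum fl g Q).1 ∧ (fastTwoSum fl g Q).1 = g + Q ∧
      |Q| ≤ |(fastTwoSum fl g Q).1| := by
  have hp1 : 1 ≤ p := le_trans (by norm_num) hp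
  have hg0 : g ≠ 0 := by
    intro h; rw [h, abs_zero] at hgbig
    exact absurd hgbig (not_le.mpr (zpow_pos (by norm_num) _))
  have hulpg : ulp p emin g ≤ |g| := ulp_le_abs_of_isFloat hg hg0
  have hQleg : |Q| ≤ |g| := hQg.trans hulpg
  obtain ⟨h1, -, h2, h4⟩ := fastTwoSum_exact hp1 hfl hg inv.hQ hQleg
  have hF12 := isFloat_fastTwoSum hfl g Q
  generalize hQn : (fastTwoSum fl g Q).1 = Qn at *
  have hQnval : Qn = g + Q := by rw [hq, add_zero] at h4; exact h4
  -- `ulp(g) ≤ |g|/2` since `g` is normal and `p ≥ 2`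
  have hulpg2 : 2 * ulp p emin g ≤ |g| := by
    have hn : (2 : ℚ) ^ (emin + p - 1) ≤ |g| :=
      le_trans (zpow_le_zpow_right₀ (by norm_num) (by omega)) hgbig
    have hu := ulp_le_of_normal hp1 hn
    have h2p : (2 : ℚ) ≤ 2 ^ (p - 1) := by
      calc (2 : ℚ) = 2 ^ 1 := by norm_num
        _ ≤ 2 ^ (p - 1) := pow_le_pow_right₀ (by norm_num) (by omega)
    have hpos : (0 : ℚ) < 2 ^ (p - 1) := by positivity
    have : ulp p emin g * 2 ^ (p - 1) ≤ |g| := by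
      have := (le_div_iff₀ hpos).mp hu; linarith
    nlinarith [ulp_pos (p := p) (emin := emin) g]
  have hQn_ge : |Q| ≤ |Qn| := by
    have h := abs_sub_abs_le_abs_sub g (-Q)
    rw [abs_neg, sub_neg_eq_add] at h
    rw [hQnval]; linarith
  refine ⟨⟨inv.floats, hF12.1, inv.pw, inv.ne, ?_, inv.sum_lt.trans_le (ulp_mono hQn_ge)⟩,
    hQnval, hQn_ge⟩
  intro r hr
  obtain ⟨⟨s, hsQ, hrs⟩, hQ0⟩ := inv.hd r hr
  have h2s : (2 : ℚ) ^ s ≤ |Q| := hsQ.two_zpow_le_abs hQ0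
  have hsg : OnGrid s g := onGrid_of_two_zpow_le_ulp hg (h2s.trans hQg)
  refine ⟨⟨s, by rw [hQnval]; exact hsg.add hsQ, hrs⟩, ?_⟩
  intro h0; rw [h0, abs_zero] at hQn_ge
  exact hQ0 (abs_eq_zero.mp (le_antisymm hQn_ge (abs_nonneg _)))

/-- What the upward sweep delivers from state `(rs, Q)` over the remaining `gs` (the output being
`rs.reverse ++ compressUp fl Q gs`): exact sum, floats, an expansion with gap `c`, "no zero
components unless nothing was ever emitted", at most `|rs| + |gs| + 1` components, and the top
component approximates the sum within its ulp. [cite: Shewchuk1997, Thm 23 p. 331–333] -/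
structure UpOut (p : ℕ) (emin : ℤ) (fl : ℚ → ℚ) (c : ℚ) (rs : List ℚ) (Q : ℚ)
    (gs out : List ℚ) : Prop where
  sum_eq : out.sum = rs.sum + Q + gs.sum
  floats : ∀ h ∈ out, IsFloat p emin h
  exp : IsExpansion c out
  nz : (∀ h ∈ out, h ≠ 0) ∨ (rs = [] ∧ compressUp fl Q gs = [Q + gs.sum])
  len : out.length ≤ rs.length + gs.length + 1
  approx : ∃ L, out.getLast? = some L ∧ |out.sum - L| < ulp p emin L

/-- **Lines 10–16 are correct**: from a state satisfying `UpInv`, over remaining components that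
are floats `≥ 2^(emin+p)` obeying the stair (relative to the exact sum passed so far) and the
chain, with the carry below the ulp of the next component, the upward sweep delivers `UpOut`.
[cite: Shewchuk1997, Thm 23 p. 333 (proof)] -/
theorem compressUp_spec (hp : 2 ≤ p) (hfl : IsRoundNearest p emin fl) {c : ℚ} (hc : 1 ≤ c)
    (hflc : RoundoffBelow c fl) :
    ∀ (gs : List ℚ) (Q : ℚ) (rs : List ℚ), UpInv p emin c rs Q →
      (∀ g ∈ gs, IsFloat p emin g) → (∀ g ∈ gs, (2 : ℚ) ^ (emin + p) ≤ |g|) →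
      UStair p emin (Q + rs.sum) gs → gs.IsChain (fun a b => |a| ≤ ulp p emin b) →
      (∀ g ∈ gs.head?, |Q| ≤ ulp p emin g) →
      UpOut p emin fl c rs Q gs (rs.reverse ++ compressUp fl Q gs) := by
  have hp1 : 1 ≤ p := le_trans (by norm_num) hp
  intro gs
  induction gs with
  | nil =>
    intro Q rs inv _ _ _ _ _
    rw [compressUp_nil]
    refine ⟨by simp [List.sum_reverse], ?_, ?_, ?_, by simp, ⟨Q, by simp, ?_⟩⟩
    · intro h hh
      rcases List.mem_append.mp hh with hh | hh
      · exact inv.floats h (List.mem_reverse.mp hh)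
      · rw [List.mem_singleton] at hh; rw [hh]; exact inv.hQ
    · show List.Pairwise (Below c) (rs.reverse ++ [Q])
      rw [List.pairwise_append]
      refine ⟨List.pairwise_reverse.mpr inv.pw, List.pairwise_singleton _ _, ?_⟩
      intro a ha b hb
      rw [List.mem_singleton] at hb; subst hb
      exact inv.below_of_mem hc a (List.mem_reverse.mp ha)
    · by_cases hrs : rs = []
      · exact Or.inr ⟨hrs, by simp⟩
      · refine Or.inl fun h hh => ?_
        rcases List.mem_append.mp hh with hh | hh
        · exact inv.ne h (List.mem_reverse.mp hh)
        · rw [List.mem_singleton] at hh; rw [hh]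
          obtain ⟨r, rs₀, rfl⟩ := List.exists_cons_of_ne_nil hrs
          exact (inv.hd r (by simp)).2
    · simpa [List.sum_reverse] using inv.sum_lt
  | cons g rest ih =>
    intro Q rs inv hF hbig hst hch hQg
    have hg : IsFloat p emin g := hF g (by simp)
    have hgbig : (2 : ℚ) ^ (emin + p) ≤ |g| := hbig g (by simp)
    have hQg' : |Q| ≤ ulp p emin g := hQg g (by simp)
    have hF' : ∀ x ∈ rest, IsFloat p emin x := fun x hx => hF x (List.mem_cons_of_mem _ hx)
    have hbig' : ∀ x ∈ rest, (2 : ℚ) ^ (emin + p) ≤ |x| :=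
      fun x hx => hbig x (List.mem_cons_of_mem _ hx)
    obtain ⟨-, hst'⟩ := uStair_cons.mp hst
    obtain ⟨hgU, hch'⟩ := List.isChain_cons.mp hch
    have hg0 : g ≠ 0 := by
      intro h; rw [h, abs_zero] at hgbig
      exact absurd hgbig (not_le.mpr (zpow_pos (by norm_num) _))
    have hulpg : ulp p emin g ≤ |g| := ulp_le_abs_of_isFloat hg hg0
    have hQleg : |Q| ≤ |g| := hQg'.trans hulpg
    obtain ⟨h1, -, h2, h4⟩ := fastTwoSum_exact hp1 hfl hg inv.hQ hQleg
    by_cases hq : (fastTwoSum fl g Q).2 = 0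
    · -- exact step
      obtain ⟨inv', hQnval, hQn_ge⟩ := inv.absorb hp hfl hg hgbig hQg' hq
      rw [compressUp_cons_of_eq_zero hq]
      generalize hQn : (fastTwoSum fl g Q).1 = Qn at *
      have hS : Qn + rs.sum = Q + rs.sum + g := by rw [hQnval]; ring
      have hQg_next : ∀ y ∈ rest.head?, |Qn| ≤ ulp p emin y := by
        intro y hy
        have hgy : |g| ≤ ulp p emin y := hgU y hy
        have hT : |Qn + rs.sum| < ulp p emin y := by rw [hS]; exact hst'.head_lt hy
        obtain ⟨u, -, hU⟩ := exists_ulp_eq_two_zpow (p := p) (emin := emin) y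
        obtain ⟨k, -, hK⟩ := exists_ulp_eq_two_zpow (p := p) (emin := emin) Q
        have hkQ : OnGrid k Q := by
          obtain ⟨K, hK'⟩ := exists_eq_int_mul_ulp_of_isFloat (p := p) (emin := emin) inv.hQ
          exact ⟨K, by rw [← hK]; exact hK'⟩
        have hkg : OnGrid k g := onGrid_of_two_zpow_le_ulp hg (by rw [← hK]; exact ulp_mono hQleg)
        have hkQn : OnGrid k Qn := by rw [hQnval]; exact hkg.add hkQ
        have hku : k ≤ u := by
          have : (2 : ℚ) ^ k ≤ (2 : ℚ) ^ u := by
            rw [← hK, ← hU]; exact (ulp_mono hQleg).trans (hulpg.trans hgy)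
          exact (zpow_le_zpow_iff_right₀ (by norm_num : (1 : ℚ) < 2)).mp this
        have hr : |rs.sum| < (2 : ℚ) ^ k := by rw [← hK]; exact inv.sum_lt
        rw [hU]
        exact abs_le_two_zpow_of_onGrid hku hkQn hr (by rw [← hU]; exact hT)
      have out := ih Qn rs inv' hF' hbig' (by rw [hS]; exact hst') hch' hQg_next
      refine ⟨by rw [out.sum_eq, hQnval, List.sum_cons]; ring, out.floats, out.exp, ?_,
        out.len.trans (by simp), out.approx⟩
      refine out.nz.imp id fun h => ⟨h.1, ?_⟩
      rw [compressUp_cons_of_eq_zero hq, hQn, h.2, hQnval, List.sum_cons]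
      simp only [List.cons.injEq, and_true]; ring
    · -- emitting step
      obtain ⟨inv', hbound⟩ := inv.emit hp hfl hc hflc hg hgbig hQg' hq
      rw [compressUp_cons_of_ne_zero hq]
      generalize hQn : (fastTwoSum fl g Q).1 = Qn at *
      generalize hqn : (fastTwoSum fl g Q).2 = q at *
      have hS : Qn + (q :: rs).sum = Q + rs.sum + g := by rw [List.sum_cons]; linarith [h4]
      have hQg_next : ∀ y ∈ rest.head?, |Qn| ≤ ulp p emin y := by
        intro y hy
        have hgy : |g| ≤ ulp p emin y := hgU y hy
        have hT : |Qn + (q :: rs).sum| < ulp p emin y := by rw [hS]; exact hst'.head_lt hy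
        obtain ⟨u, hu, hU⟩ := exists_ulp_eq_two_zpow (p := p) (emin := emin) y
        obtain ⟨k, -, hK⟩ := exists_ulp_eq_two_zpow (p := p) (emin := emin) (g + Q)
        have hkQn : OnGrid k Qn := by
          obtain ⟨K, hK'⟩ := exists_fl_eq_int_mul_ulp hp1 hfl (g + Q)
          exact ⟨K, by rw [h1, hK', hK]⟩
        have hku : k ≤ u := by
          have ht2 : |g + Q| ≤ 2 * (2 : ℚ) ^ u :=
            calc |g + Q| ≤ |g| + |Q| := abs_add_le _ _
              _ ≤ |g| + |g| := by linarith
              _ ≤ 2 * (2 : ℚ) ^ u := by rw [← hU]; linarith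
          have := ulp_le_two_zpow_of_abs_le hp hu ht2
          rw [hK] at this
          exact (zpow_le_zpow_iff_right₀ (by norm_num : (1 : ℚ) < 2)).mp this
        have hr : |(q :: rs).sum| < (2 : ℚ) ^ k := by rw [← hK, List.sum_cons]; exact hbound
        rw [hU]
        exact abs_le_two_zpow_of_onGrid hku hkQn hr (by rw [← hU]; exact hT)
      have out := ih Qn (q :: rs) inv' hF' hbig' (by rw [hS]; exact hst') hch' hQg_next
      have hlist : rs.reverse ++ q :: compressUp fl Qn rest =
          (q :: rs).reverse ++ compressUp fl Qn rest := by simp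
      rw [hlist]
      refine ⟨by rw [out.sum_eq, List.sum_cons, List.sum_cons]; linarith [h4], out.floats, out.exp,
        Or.inl (out.nz.elim id fun h => absurd h.1 (List.cons_ne_nil _ _)),
        out.len.trans (by simp; omega), out.approx⟩

/-! ### Theorem 23 -/

/-- The conclusions of Theorem 23 for `h = COMPRESS(e)`: `Σ h = Σ e`; the `hᵢ` are floats; `h` is an
expansion with gap `c` (nonoverlapping for `c = 1`, nonadjacent for `c = 2`); "if `h ≠ 0`, none of
the `hᵢ` will be zero" (every component nonzero, or `h = [Σ e]`); `n ≤ m`; and "`h_n` approximates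
`h` with an error smaller than `ulp(h_n)`". [cite: Shewchuk1997, Thm 23 p. 331] -/
structure CompressOut (p : ℕ) (emin : ℤ) (c : ℚ) (e h : List ℚ) : Prop where
  sum_eq : h.sum = e.sum
  floats : ∀ x ∈ h, IsFloat p emin x
  exp : IsExpansion c h
  nz : (∀ x ∈ h, x ≠ 0) ∨ h = [e.sum]
  len : h.length ≤ e.length
  approx : ∀ L ∈ h.getLast?, |h.sum - L| < ulp p emin L

/-- **THEOREM 23** (any round-to-nearest whose roundoff lies `c`-below the rounded value,
`1 ≤ c`; `p ≥ 2`; gradual underflow): COMPRESS of a nonoverlapping expansion of floats.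
[cite: Shewchuk1997, Thm 23 p. 331–333] -/
theorem compress_spec (hp : 2 ≤ p) (hfl : IsRoundNearest p emin fl) {c : ℚ} (hc : 1 ≤ c)
    (hflc : RoundoffBelow c fl) {e : List ℚ} (he : ∀ x ∈ e, IsFloat p emin x)
    (hexp : IsExpansion 1 e) : CompressOut p emin c e (compress fl e) := by
  cases hrev : e.reverse with
  | nil =>
    have he0 : e = [] := by simpa using congrArg List.reverse hrev
    subst he0
    simp only [compress, List.reverse_nil]
    exact ⟨rfl, by simp, List.Pairwise.nil, Or.inl (by simp), le_rfl, by simp⟩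
  | cons em rest =>
    have he' : e = rest.reverse ++ [em] := by simpa using congrArg List.reverse hrev
    have hcomp : compress fl e =
        compressUp fl (compressDown fl em rest).2 (compressDown fl em rest).1.reverse := by
      simp only [compress, hrev]
    rw [hcomp]
    subst he'
    have hem : IsFloat p emin em := he em (by simp)
    have hrestF : ∀ y ∈ rest, IsFloat p emin y := fun y hy => he y (by simp [hy])
    have hexp' : IsExpansion 1 rest.reverse := hexp.sublist (List.sublist_append_left _ _)
    have hbel : ∀ y ∈ rest, Below 1 y em := fun y hy =>
      (List.pairwise_append.mp hexp).2.2 y (List.mem_reverse.mpr hy) em (by simp)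
    have outd := compressDown_spec hp hfl rest em hem hrestF hexp' hbel
    generalize hgs : (compressDown fl em rest).1 = gs at *
    generalize hgb : (compressDown fl em rest).2 = gb at *
    have inv : UpInv p emin c [] gb :=
      ⟨by simp, outd.hgb, List.Pairwise.nil, by simp, by simp, by simpa using ulp_pos _⟩
    have hst : UStair p emin (gb + ([] : List ℚ).sum) gs.reverse := by
      have h := uStair_reverse_of_dStair outd.stair
      rw [List.reverse_append, List.reverse_singleton, List.singleton_append, uStair_cons,
        zero_add] at h
      simpa using h.2
    have hch0 := List.isChain_reverse.mpr outd.chain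
    rw [List.reverse_append, List.reverse_singleton, List.singleton_append,
      List.isChain_cons] at hch0
    have outu := compressUp_spec hp hfl hc hflc gs.reverse gb [] inv
      (fun g hg => outd.floats g (List.mem_reverse.mp hg))
      (fun g hg => outd.big g (List.mem_reverse.mp hg)) hst hch0.2 hch0.1
    rw [List.reverse_nil, List.nil_append] at outu
    have hsum_e : (rest.reverse ++ [em]).sum = em + rest.sum := by
      simp [List.sum_reverse]; ring
    refine ⟨?_, outu.floats, outu.exp, ?_, ?_, ?_⟩
    · rw [outu.sum_eq, hsum_e, List.sum_reverse, List.sum_nil, ← outd.sum_eq]; ring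
    · refine outu.nz.imp id fun h => ?_
      rw [h.2, hsum_e, List.sum_reverse, ← outd.sum_eq]
      simp only [List.cons.injEq, and_true]; ring
    · have h1 := outu.len
      have h2 := outd.len
      simp only [List.length_nil, List.length_reverse, zero_add, List.length_append,
        List.length_singleton] at h1 h2 ⊢
      omega
    · intro L hL
      obtain ⟨L', hL', happ⟩ := outu.approx
      rw [hL'] at hL
      have : L' = L := by simpa using hL
      subst this
      exact happ

/-- **THEOREM 23, `h = e`**. [cite: Shewchuk1997, Thm 23 p. 331] -/
theorem compress_sum (hp : 2 ≤ p) (hfl : IsRoundNearest p emin fl) {e : List ℚ}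
    (he : ∀ x ∈ e, IsFloat p emin x) (hexp : IsExpansion 1 e) :
    (compress fl e).sum = e.sum :=
  (compress_spec hp hfl le_rfl (roundoffBelow_one (le_trans (by norm_num) hp) hfl) he hexp).sum_eq

/-- **THEOREM 23, "h is a nonoverlapping expansion"** (any tie rule), with the no-zero and
approximation clauses. [cite: Shewchuk1997, Thm 23 p. 331] -/
theorem compress_nonoverlapping (hp : 2 ≤ p) (hfl : IsRoundNearest p emin fl) {e : List ℚ}
    (he : ∀ x ∈ e, IsFloat p emin x) (hexp : IsExpansion 1 e) :
    CompressOut p emin 1 e (compress fl e) :=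
  compress_spec hp hfl le_rfl (roundoffBelow_one (le_trans (by norm_num) hp) hfl) he hexp

/-- **THEOREM 23, "the components hᵢ are in order of increasing magnitude"** — strictly, since no
component is zero unless `h` is a single component. [cite: Shewchuk1997, Thm 23 p. 331] -/
theorem compress_pairwise_abs_lt (hp : 2 ≤ p) (hfl : IsRoundNearest p emin fl) {e : List ℚ}
    (he : ∀ x ∈ e, IsFloat p emin x) (hexp : IsExpansion 1 e) :
    (compress fl e).Pairwise (fun a b => |a| < |b|) := by
  have out := compress_nonoverlapping hp hfl he hexp
  rcases out.nz with hnz | hsingle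
  · exact out.exp.imp_of_mem fun {a b} _ hb hab => hab.abs_lt le_rfl (hnz b hb)
  · rw [hsingle]; exact List.pairwise_singleton _ _

/-- **THEOREM 23, "(nonadjacent if round-to-even tiebreaking is used)"**: the paper's setting.
[cite: Shewchuk1997, Thm 23 p. 331; Cor 9 p. 315] -/
theorem compress_nonadjacent_roundTiesEven (hp : 2 ≤ p) {e : List ℚ}
    (he : ∀ x ∈ e, IsFloat p emin x) (hexp : IsExpansion 1 e) :
    CompressOut p emin 2 e (compress (roundTiesEven p emin) e) :=
  compress_spec hp (isRoundNearest_roundTiesEven (le_trans (by norm_num) hp)) (by norm_num)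
    (roundoffBelow_two_roundTiesEven p emin) he hexp

end Literature.ComputerArithmetic.Shewchuk1997
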